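import Summits.CriticalPhenomena.PercolationContinuityZ3.Theorems.PercNearOneGluingNoHeavyConstsMDLXJointXEdgeInduction
import HarnessLib

/-!
# CROSS at `u = z` on the marker-SATURATED quadrant, EDGE up-sets: every monotone 0/1-valued functional of the open edge cluster that is `1` on `{s↔y}`

builds on p205010 (kernel theorem, internal audit signed; external expert review pending).  Support file (`--supports
stmt-CriticalPhenomena-4575`); theorems only, no sorries, standard axioms.  Memo `run/shared/lean/prim/consts/FROM-prim-consts-2-g21-GIBBS-ORBIT.md` §3, §5(v).

`Consts.CrossRel` quantifies over monotone functionals `F` of the open EDGE cluster `C_s`; by layer cake it is a statement about edge UP-SETS.  The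
companion file `…ConstsCrossReachMarkerSaturated.lean` (`Consts.crossRel_reach_of_markerSaturated_of_corner`) treats the VERTEX up-events `1{V(C_s) ∈ 𝒰}`
containing `{y ∈ V(C_s)}`; THIS file proves the same reduction for every EDGE up-set containing `{s↔y}`:
* `Consts.crossRel_edge_of_markerSaturated_of_corner` — for `F` monotone with values in `{0,1}` and `F(C_s) = 1` whenever `s↔y`, BOTH `u = z` members of
  `Consts.CrossRel` (`X' = X ∪ {z}`) are `≥ 0` PROVIDED they are `≥ 0` at the corner `F = 1{s↔y}` (hypotheses `hY1`, `hY2` — instances of the marker-pinned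
  theorems `Consts.crossRel_reach_M1/M2_of_markerPinned_of_exchanges` at `𝒰 = (y ∈ ·)`).  Proof = the corner transfer of the companion file: with
  `V = Uᶜ ⊆ N = {s↮y}`, `zv = μ((D∖U)∩Z)`, `z̄v = μ((D∖U)∖Z)`, EXACTLY `M₂(U) = z̄v·(t'dz − tw·dy') − t'd'·zv` and
  `M₁(U) = z̄v·[(t+t')dz − tw(dy+dy')] − zv·[(t+t')d' + tw·dy']` (coefficients independent of `U`), and van den Berg–Häggström–Kahn's Theorem 1.3 (edge
  cluster of `s` given `s ↮ X∪{y}`; the tree's `BHK2006_setClusterConditionalPositiveAssociation` with the functionals `1{s↔z}` and `F` itself) gives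
  `zv·z̄n ≤ zn·z̄v`, which transfers the two inequalities from `U = Y` to `U`.
So at `u = z` the edge-functional status of CROSS is: `U ⊆ Z` (…CrossReach, class I) and `U ⊇ Y` (this file, given the corner) reduced; `U ⊇ Z` modulo (F1);
`U ⊆ Y` needs the EDGE-cluster version of the two-source exchange theorem `Consts.localEv_fourEvents` (open, memo §5(v)); generic class open.
-/

noncomputable section

namespace Summit.CriticalPhenomena.PercolationContinuityZ3.Theorems

open MeasureTheory Set Literature.Probability.LatticeModels Literature.Probability.Percolation
open scoped Classical

namespace Consts

variable {V : Type*} [Fintype V]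

omit [Fintype V] in
/-- `{s ↮ X ∪ {z}} = {s ↮ X} ∖ {s ↔ z}`. [folklore] -/
private theorem avoid_insert_eq_diff₄ (s z : V) (X : Set V) :
    {ω : BondConfig V | ∀ x ∈ insert z X, ¬ (openGraph ω).Reachable s x} =
      {ω : BondConfig V | ∀ x ∈ X, ¬ (openGraph ω).Reachable s x} \ openConn s z := by
  ext ω; simp only [mem_setOf_eq, forall_mem_insert, mem_sdiff, openConn]; tauto

omit [Fintype V] in
/-- The copy-0 event of the `X ∪ {z}`-slot is disjoint from `{y ↔ z}`. [folklore] -/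
private theorem avoidY_insert_inter_conn_eq_empty₄ (s y z : V) (X : Set V) (S : Set (BondConfig V)) :
    {ω : BondConfig V | ∀ x ∈ insert s (insert z X), ¬ (openGraph ω).Reachable y x} ∩ S ∩ openConn y z = ∅ := by
  refine Set.eq_empty_of_forall_notMem fun ω hω => ?_
  exact hω.1.1 z (mem_insert_of_mem s (mem_insert z X)) hω.2

omit [Fintype V] in
/-- From the corner to the quadrant: if `z̄n·A ≥ B·zn`, `zv·z̄n ≤ zn·z̄v`, `B ≥ 0`, `0 ≤ zv ≤ zn`, `0 ≤ z̄v ≤ z̄n` then `z̄v·A ≥ B·zv`. [folklore] -/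
private theorem markerSaturated_transfer₄ (A B zv zbv zn zbn : ℝ) (hB : 0 ≤ B) (hzv : 0 ≤ zv) (hzbv : 0 ≤ zbv) (hzvn : zv ≤ zn)
    (hzbvn : zbv ≤ zbn) (hcorner : B * zn ≤ zbn * A) (hcpa : zv * zbn ≤ zn * zbv) : B * zv ≤ zbv * A := by
  rcases lt_or_ge 0 zbn with hpos | hle
  · -- multiply the target by `zbn > 0`
    have h1 : zbn * (B * zv) ≤ zbn * (zbv * A) := by nlinarith [mul_le_mul_of_nonneg_left hcpa hB, mul_le_mul_of_nonneg_left hcorner hzbv]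
    exact le_of_mul_le_mul_left h1 hpos
  · have hzbn0 : zbn = 0 := le_antisymm hle (le_trans hzbv hzbvn)
    have hzbv0 : zbv = 0 := le_antisymm (hzbn0 ▸ hzbvn) hzbv
    have hBzn : B * zn = 0 := le_antisymm (by simpa [hzbn0] using hcorner) (mul_nonneg hB (le_trans hzv hzvn))
    have hBzv : B * zv ≤ 0 := by nlinarith [mul_le_mul_of_nonneg_left hzvn hB]
    rw [hzbv0, zero_mul]; exact hBzv

set_option maxHeartbeats 400000 in
/-- **CROSS at `u = z` on the marker-saturated quadrant, EDGE up-sets, from the corner.**  See the module docstring.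
[cite: VandenbergHaggstromKahn2005, Thm. 1.3 (p. 6) with Remark 1 after Thm. 1.2 (p. 5)] -/
theorem crossRel_edge_of_markerSaturated_of_corner (w : Sym2 V → unitInterval) (s y z : V) (X : Set V)
    (F : Set (Sym2 V) → ℝ) (hFm : Monotone F) (hF01 : ∀ C, F C = 0 ∨ F C = 1)
    (hFY : ∀ ω : BondConfig V, (openGraph ω).Reachable s y → F (openEdgeCluster ω s) = 1)
    (hY1 : 0 ≤ polMargin (prodBernoulli w) s y z (connIndicatorFn s y) (insert z X) X X +
          polMargin (prodBernoulli w) s y z (connIndicatorFn s y) X (insert z X) X +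
        polMargin (prodBernoulli w) s y z (connIndicatorFn s y) X X (insert z X))
    (hY2 : 0 ≤ polMargin (prodBernoulli w) s y z (connIndicatorFn s y) (insert z X) (insert z X) X +
          polMargin (prodBernoulli w) s y z (connIndicatorFn s y) (insert z X) X (insert z X) +
        polMargin (prodBernoulli w) s y z (connIndicatorFn s y) X (insert z X) (insert z X)) :
    (0 ≤ polMargin (prodBernoulli w) s y z F (insert z X) X X + polMargin (prodBernoulli w) s y z F X (insert z X) X +
        polMargin (prodBernoulli w) s y z F X X (insert z X)) ∧
      0 ≤ polMargin (prodBernoulli w) s y z F (insert z X) (insert z X) X +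
          polMargin (prodBernoulli w) s y z F (insert z X) X (insert z X) +
        polMargin (prodBernoulli w) s y z F X (insert z X) (insert z X) := by
  classical
  set μ := prodBernoulli w with hμ
  -- degenerate case `z = s`
  by_cases hzs : z = s
  · subst hzs
    have h0 : ∀ (G : Set (Sym2 V) → ℝ) (X₁ X₂ : Set V), polMargin μ z y z G (insert z X) X₁ X₂ = 0 := fun G X₁ X₂ =>
      polMargin_eq_zero_of_slot0 μ z y z G _ X₁ X₂ (Or.inl (mem_insert z X))
    have h1 : ∀ (G : Set (Sym2 V) → ℝ) (X₀ X₂ : Set V), polMargin μ z y z G X₀ (insert z X) X₂ = 0 := fun G X₀ X₂ =>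
      polMargin_eq_zero_of_slot1 μ z y z G X₀ _ X₂ (mem_insert z X)
    have h2 : ∀ (G : Set (Sym2 V) → ℝ) (X₀ X₁ : Set V), polMargin μ z y z G X₀ X₁ (insert z X) = 0 := fun G X₀ X₁ =>
      polMargin_eq_zero_of_slot2 μ z y z G X₀ X₁ _ (mem_insert z X)
    refine ⟨?_, ?_⟩
    · rw [h0, h1, h2]; norm_num
    · rw [h0, h0, h2]; norm_num
  have hmeas : ∀ S : Set (BondConfig V), MeasurableSet S := fun _ => MeasurableSet.of_discrete
  set D : Set (BondConfig V) := {ω | ∀ x ∈ X, ¬ (openGraph ω).Reachable s x} with hD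
  set D' : Set (BondConfig V) := {ω | ∀ x ∈ insert z X, ¬ (openGraph ω).Reachable s x} with hD'
  set A : Set (BondConfig V) := {ω | ∀ x ∈ insert s X, ¬ (openGraph ω).Reachable y x} with hA
  set A' : Set (BondConfig V) := {ω | ∀ x ∈ insert s (insert z X), ¬ (openGraph ω).Reachable y x} with hA'
  set Yv : Set (BondConfig V) := openConn s y with hYv
  set Zv : Set (BondConfig V) := openConn s z with hZv
  set Wv : Set (BondConfig V) := openConn y z with hWv
  set U : Set (BondConfig V) := {ω | F (openEdgeCluster ω s) = 1} with hU
  set E : Set (BondConfig V) := {ω | ∀ a ∈ ({s} : Set V), ∀ t ∈ insert y X, ¬ (openGraph ω).Reachable a t} with hE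
  have mD' : ∀ ω, ω ∈ D' ↔ ¬ (openGraph ω).Reachable s z ∧ ∀ x ∈ X, ¬ (openGraph ω).Reachable s x := fun ω => by
    simp only [hD', mem_setOf_eq, forall_mem_insert]
  have mE : ∀ ω, ω ∈ E ↔ ¬ (openGraph ω).Reachable s y ∧ ∀ x ∈ X, ¬ (openGraph ω).Reachable s x := fun ω => by
    simp only [hE, mem_setOf_eq, mem_singleton_iff, forall_eq, forall_mem_insert]
  have mD : ∀ ω, ω ∈ D ↔ ∀ x ∈ X, ¬ (openGraph ω).Reachable s x := fun ω => Iff.rfl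
  have mY : ∀ ω, ω ∈ Yv ↔ (openGraph ω).Reachable s y := fun ω => Iff.rfl
  have mZ : ∀ ω, ω ∈ Zv ↔ (openGraph ω).Reachable s z := fun ω => Iff.rfl
  have mU : ∀ ω, ω ∈ U ↔ F (openEdgeCluster ω s) = 1 := fun ω => Iff.rfl
  -- `Y ⊆ U`
  have hYU : ∀ ω, (openGraph ω).Reachable s y → ω ∈ U := fun ω h => hFY ω h
  -- the two functionals on clusters
  have hFU : ∀ ω : BondConfig V, F (openEdgeCluster ω s) = U.indicator 1 ω := by
    intro ω
    rcases hF01 (openEdgeCluster ω s) with h | h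
    · have hn : ω ∉ U := by rw [mU, h]; norm_num
      rw [h, indicator_of_notMem hn]
    · rw [indicator_of_mem (show ω ∈ U from h), Pi.one_apply, h]
  have hI : ∀ S : Set (BondConfig V), ∫ ω in S, F (openEdgeCluster ω s) ∂μ = μ.real (S ∩ U) := by
    intro S; simp_rw [hFU]; exact TripodExchange.setIntegral_indicator_one_eq w S U
  have hIY : ∀ S : Set (BondConfig V), ∫ ω in S, connIndicatorFn s y (openEdgeCluster ω s) ∂μ = μ.real (S ∩ Yv) := by
    intro S; simp_rw [connIndicatorFn_openEdgeCluster]; exact TripodExchange.setIntegral_indicator_one_eq w S Yv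
  -- set identities
  have sD' : D' = D \ Zv := avoid_insert_eq_diff₄ s z X
  have sD'Z : D' ∩ Zv = ∅ := by rw [sD']; exact Set.sdiff_inter_self
  have sD'ZU : D' ∩ Zv ∩ U = ∅ := by rw [sD'Z, Set.empty_inter]
  have sD'ZY : D' ∩ Zv ∩ Yv = ∅ := by rw [sD'Z, Set.empty_inter]
  have sA'W : A' ∩ D' ∩ Wv = ∅ := avoidY_insert_inter_conn_eq_empty₄ s y z X D'
  have sDYU : D ∩ Yv ∩ U = D ∩ Yv := by
    ext ω; simp only [mem_inter_iff, mY]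
    constructor
    · rintro ⟨h, -⟩; exact h
    · rintro ⟨hd, hy⟩; exact ⟨⟨hd, hy⟩, hYU ω hy⟩
  have sD'YU : D' ∩ Yv ∩ U = D' ∩ Yv := by
    ext ω; simp only [mem_inter_iff, mY]
    constructor
    · rintro ⟨h, -⟩; exact h
    · rintro ⟨hd, hy⟩; exact ⟨⟨hd, hy⟩, hYU ω hy⟩
  have sYY : ∀ S : Set (BondConfig V), S ∩ Yv ∩ Yv = S ∩ Yv := fun S => by rw [inter_assoc, inter_self]
  have sDZu : (D ∩ Zv) \ U = (D \ U) ∩ Zv := by ext ω; simp only [mem_inter_iff, mem_sdiff]; tauto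
  have sDzu : (D \ Zv) \ U = (D \ U) \ Zv := by ext ω; simp only [mem_sdiff]; tauto
  have sDZn : (D ∩ Zv) \ Yv = (D \ Yv) ∩ Zv := by ext ω; simp only [mem_inter_iff, mem_sdiff]; tauto
  have sDzn : (D \ Zv) \ Yv = (D \ Yv) \ Zv := by ext ω; simp only [mem_sdiff]; tauto
  have sDN : D \ Yv = E := by ext ω; simp only [mem_sdiff, mD, mE, mY]; tauto
  have sEV : E \ U = D \ U := by
    ext ω; simp only [mem_sdiff, mE, mD]
    constructor
    · rintro ⟨⟨-, hd⟩, hu⟩; exact ⟨hd, hu⟩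
    · rintro ⟨hd, hu⟩; exact ⟨⟨fun h => hu (hYU ω h), hd⟩, hu⟩
  -- atoms
  set d := μ.real D with hd
  set dz := μ.real (D ∩ Zv) with hdz
  set t := μ.real (A ∩ D) with ht
  set tw := μ.real (A ∩ D ∩ Wv) with htw
  set tp := μ.real (A' ∩ D') with htp
  set zv := μ.real ((D \ U) ∩ Zv) with hzv
  set zbv := μ.real ((D \ U) \ Zv) with hzbv
  set zn := μ.real ((D \ Yv) ∩ Zv) with hzn
  set zbn := μ.real ((D \ Yv) \ Zv) with hzbn
  have h0 : ∀ S : Set (BondConfig V), 0 ≤ μ.real S := fun _ => measureReal_nonneg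
  -- splits
  have r1 : μ.real (D \ U) = zv + zbv := by
    have h := measureReal_inter_add_sdiff (μ := μ) (s := D \ U) (hmeas Zv); linarith
  have r2 : μ.real (D ∩ U) = d - (zv + zbv) := by
    have h := measureReal_inter_add_sdiff (μ := μ) (s := D) (hmeas U); rw [r1] at h; linarith
  have r3 : μ.real (D ∩ Zv ∩ U) = dz - zv := by
    have h := measureReal_inter_add_sdiff (μ := μ) (s := D ∩ Zv) (hmeas U); rw [sDZu] at h; linarith
  have r4 : μ.real D' = d - dz := by
    have h := measureReal_inter_add_sdiff (μ := μ) (s := D) (hmeas Zv); rw [← sD'] at h; linarith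
  have r5 : μ.real (D' ∩ U) = (d - dz) - zbv := by
    have h := measureReal_inter_add_sdiff (μ := μ) (s := D') (hmeas U); rw [sD', sDzu, ← sD', r4] at h; linarith
  have r6 : μ.real (D \ Yv) = zn + zbn := by
    have h := measureReal_inter_add_sdiff (μ := μ) (s := D \ Yv) (hmeas Zv); linarith
  have r7 : μ.real (D ∩ Yv) = d - (zn + zbn) := by
    have h := measureReal_inter_add_sdiff (μ := μ) (s := D) (hmeas Yv); rw [r6] at h; linarith
  have r8 : μ.real (D ∩ Zv ∩ Yv) = dz - zn := by
    have h := measureReal_inter_add_sdiff (μ := μ) (s := D ∩ Zv) (hmeas Yv); rw [sDZn] at h; linarith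
  have r9 : μ.real (D' ∩ Yv) = (d - dz) - zbn := by
    have h := measureReal_inter_add_sdiff (μ := μ) (s := D') (hmeas Yv); rw [sD', sDzn, ← sD', r4] at h; linarith
  have r10 : μ.real (D' ∩ Zv ∩ U) = 0 := by rw [sD'ZU, measureReal_empty]
  have r11 : μ.real (D' ∩ Zv ∩ Yv) = 0 := by rw [sD'ZY, measureReal_empty]
  have r12 : μ.real (D' ∩ Zv) = 0 := by rw [sD'Z, measureReal_empty]
  have r13 : μ.real (A' ∩ D' ∩ Wv) = 0 := by rw [sA'W, measureReal_empty]
  have hzvn : zv ≤ zn := measureReal_mono (fun ω hω => by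
    simp only [mem_inter_iff, mem_sdiff, mY] at hω ⊢; exact ⟨⟨hω.1.1, fun h => hω.1.2 (hYU ω h)⟩, hω.2⟩)
  have hzbvn : zbv ≤ zbn := measureReal_mono (fun ω hω => by
    simp only [mem_sdiff, mY] at hω ⊢; exact ⟨⟨hω.1.1, fun h => hω.1.2 (hYU ω h)⟩, hω.2⟩)
  -- CPA given `s ↮ X ∪ {y}`: `μ(E)·μ(E ∩ Z ∩ U) ≥ μ(E ∩ Z)·μ(E ∩ U)`
  have hF₁ω : ∀ ω : BondConfig V, connIndicatorFn s z (⋃ a ∈ ({s} : Set V), openEdgeCluster ω a) = Zv.indicator 1 ω := by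
    intro ω
    have : (⋃ a ∈ ({s} : Set V), openEdgeCluster ω a) = openEdgeCluster ω s := by ext e; simp
    rw [this, connIndicatorFn_openEdgeCluster]
  have hG₁ω : ∀ ω : BondConfig V, F (⋃ a ∈ ({s} : Set V), openEdgeCluster ω a) = U.indicator 1 ω := by
    intro ω
    have hC : (⋃ a ∈ ({s} : Set V), openEdgeCluster ω a) = openEdgeCluster ω s := by ext e; simp
    rw [hC, hFU]
  have hcpa := BHK2006_setClusterConditionalPositiveAssociation w ({s} : Set V) (insert y X) (connIndicatorFn s z) F
    (monotone_connIndicatorFn s z) hFm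
  simp only [hF₁ω, hG₁ω] at hcpa
  change (∫ ω in E, Zv.indicator 1 ω ∂μ) * (∫ ω in E, U.indicator 1 ω ∂μ) ≤
    μ.real E * ∫ ω in E, Zv.indicator 1 ω * U.indicator 1 ω ∂μ at hcpa
  rw [TripodExchange.setIntegral_indicator_one_eq, TripodExchange.setIntegral_indicator_one_eq,
    TripodExchange.setIntegral_indicator_mul_indicator_eq] at hcpa
  -- `E = D ∖ Y`; express in atoms: μ(E) = zn+zbn, μ(E∩Zv) = zn, μ(E∩U) = μ(E) − μ(E∖U), μ(E∩(Zv∩U)) = zn − zv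
  have rE : μ.real E = zn + zbn := by rw [← sDN, r6]
  have rEZ : μ.real (E ∩ Zv) = zn := by rw [← sDN, hzn]
  have rEU : μ.real (E ∩ U) = (zn + zbn) - (zv + zbv) := by
    have h := measureReal_inter_add_sdiff (μ := μ) (s := E) (hmeas U); rw [sEV, r1, rE] at h; linarith
  have rEZU : μ.real (E ∩ (Zv ∩ U)) = zn - zv := by
    have h := measureReal_inter_add_sdiff (μ := μ) (s := E ∩ Zv) (hmeas U)
    have h2 : (E ∩ Zv) \ U = (D \ U) ∩ Zv := by
      rw [← sDN]; ext ω; simp only [mem_inter_iff, mem_sdiff, mY]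
      constructor
      · rintro ⟨⟨⟨hd, -⟩, hz⟩, hu⟩; exact ⟨⟨hd, hu⟩, hz⟩
      · rintro ⟨⟨hd, hu⟩, hz⟩; exact ⟨⟨⟨hd, fun h => hu (hYU ω h)⟩, hz⟩, hu⟩
    rw [h2, rEZ, ← hzv] at h
    rw [← inter_assoc]; linarith
  rw [rE, rEZ, rEU, rEZU] at hcpa
  have hcpa' : zv * zbn ≤ zn * zbv := by nlinarith [hcpa]
  -- the hypotheses and the goal in atoms
  unfold polMargin at hY1 hY2 ⊢
  rw [hIY, hIY, hIY, hIY, hIY, hIY, sYY, sYY, r13, r12, r11, r8, r7, r9, r4] at hY1 hY2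
  rw [hI, hI, hI, hI, hI, hI, sDYU, sD'YU, r13, r12, r10, r3, r2, r5, r7, r9, r4]
  have htp0 : 0 ≤ tp := h0 _
  have htw0 : 0 ≤ tw := h0 _
  have ht0 : 0 ≤ t := h0 _
  have hd'0 : 0 ≤ d - dz := by rw [← r4]; exact h0 _
  have hdy'0 : 0 ≤ d - dz - zbn := by rw [← r9]; exact h0 _
  refine ⟨?_, ?_⟩
  · -- M₁ = z̄v·α − zv·β, α = (t+t')dz − tw(dy + dy'), β = (t+t')d' + tw dy'
    have e : ∀ a b : ℝ, tp * (d * (dz - a) - (d - (a + b)) * dz) - 0 * (d * (d - (zn + zbn)) - (d - (a + b)) * (d - (zn + zbn))) +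
        (t * ((d - dz) * (dz - a) - ((d - dz) - b) * dz) - tw * ((d - dz) * (d - (zn + zbn)) - ((d - dz) - b) * (d - (zn + zbn)))) +
        (t * (d * 0 - (d - (a + b)) * 0) - tw * (d * ((d - dz) - zbn) - (d - (a + b)) * ((d - dz) - zbn))) =
        b * ((t + tp) * dz - tw * ((d - (zn + zbn)) + ((d - dz) - zbn))) - ((t + tp) * (d - dz) + tw * ((d - dz) - zbn)) * a := by
      intro a b; ring
    rw [e zn zbn] at hY1; rw [e zv zbv]
    have hB : 0 ≤ (t + tp) * (d - dz) + tw * ((d - dz) - zbn) := by positivity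
    have hc : ((t + tp) * (d - dz) + tw * ((d - dz) - zbn)) * zn ≤
        zbn * ((t + tp) * dz - tw * ((d - (zn + zbn)) + ((d - dz) - zbn))) := by linarith [hY1]
    linarith [markerSaturated_transfer₄ ((t + tp) * dz - tw * ((d - (zn + zbn)) + ((d - dz) - zbn)))
      ((t + tp) * (d - dz) + tw * ((d - dz) - zbn)) zv zbv zn zbn hB (h0 _) (h0 _) hzvn hzbvn hc hcpa']
  · -- M₂ = z̄v·(t'dz − tw dy') − t'd'·zv
    have e : ∀ a b : ℝ, tp * ((d - dz) * (dz - a) - ((d - dz) - b) * dz) - 0 * ((d - dz) * (d - (zn + zbn)) - ((d - dz) - b) * (d - (zn + zbn))) +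
        (tp * (d * 0 - (d - (a + b)) * 0) - 0 * (d * ((d - dz) - zbn) - (d - (a + b)) * ((d - dz) - zbn))) +
        (t * ((d - dz) * 0 - ((d - dz) - b) * 0) - tw * ((d - dz) * ((d - dz) - zbn) - ((d - dz) - b) * ((d - dz) - zbn))) =
        b * (tp * dz - tw * ((d - dz) - zbn)) - (tp * (d - dz)) * a := by
      intro a b; ring
    rw [e zn zbn] at hY2; rw [e zv zbv]
    have hB : 0 ≤ tp * (d - dz) := mul_nonneg htp0 hd'0
    have hc : (tp * (d - dz)) * zn ≤ zbn * (tp * dz - tw * ((d - dz) - zbn)) := by linarith [hY2]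
    linarith [markerSaturated_transfer₄ (tp * dz - tw * ((d - dz) - zbn)) (tp * (d - dz)) zv zbv zn zbn hB (h0 _) (h0 _) hzvn hzbvn hc hcpa']

end Consts

end Summit.CriticalPhenomena.PercolationContinuityZ3.Theorems

end
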